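import Literature.Geometry.Riemannian.ColdingMinicozziEntropyDensity
import HarnessLib

/-!
# Gaussian densities of a set which is locally a `C¹` graph: `F_{y₀,t}(S) → 1`

Topic `Literature/Geometry/Riemannian`.  The local form of Colding–Minicozzi 2012, Lemma 7.2 (3)
(`ColdingMinicozziEntropyDensity.lean` treats `Σ = f(M)`, `M` compact): let `S ⊆ F` be a
measurable subset of a real inner product space which, near the point `y₀ = g u₀`, coincides
with the image of a `C¹` germ `g : E_M → F` (`dim E_M = n`) with injective differential at `u₀`
— `g(N) ⊆ S` for some neighbourhood `N` of `u₀`, and for EVERY neighbourhood `N` of `u₀` there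
is `δ > 0` with `S ∩ B(y₀, δ) ⊆ g(N)` — and whose Gaussian areas centred at `y₀` are bounded,
`F_{y₀,t}(S) ≤ Λ < ∞` for all `t > 0` (the substitute for compactness: it controls the far
part).  Then `F_{y₀,t}(S) → 1` as `t → 0⁺` (`tendsto_gaussianArea_nhdsGT_zero_of_localGraph`).
This is the density-one property White uses for the blow-up limit flows ("`Θ(M′, 0, 1) = 1` by
direct calculation", White 2005 p. 1497), whose slices are entire, non-compact, locally
`C^{2,α}`-graphical submanifolds with bounded Gaussian density ratios.

* `gaussianArea_diff_ball_le` — the far part under a Gaussian bound: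
  `F_{p,t}(S ∖ B(p, δ)) ≤ 2^{n/2} e^{-δ²/8t} F_{p,2t}(S)`;
* `tendsto_gaussianArea_nhdsGT_zero_of_localGraph` — the theorem.

Everything is PROVED (the near part is verbatim the argument of
`tendsto_gaussianArea_range_nhdsGT_zero`); no definitions, no named facts.

## References

* T. H. Colding, W. P. Minicozzi II, *Generic mean curvature flow I; generic singularities*,
  Ann. of Math. 175 (2012) 755–833, Lemma 7.2 (3). [ColdingMinicozzi2012]
* B. White, *A local regularity theorem for mean curvature flow*, Ann. of Math. 161 (2005),
  §2.9–2.10, p. 1497. [White2005]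
-/

noncomputable section

namespace Literature.Geometry.Riemannian

open Set Function Filter Module Metric
open _root_.MeasureTheory _root_.MeasureTheory.Measure
open scoped ENNReal NNReal Topology

/-! ### The far part under a Gaussian bound -/

section Far

variable {F : Type*} [NormedAddCommGroup F] [MeasurableSpace F] [BorelSpace F]

omit [MeasurableSpace F] [BorelSpace F] in
/-- Weight comparison off the ball: for `‖x - p‖ ≥ δ`,
`e^{-‖x-p‖²/4t} ≤ e^{-δ²/8t} e^{-‖x-p‖²/(4·2t)}`. [folklore] -/
theorem gaussianWeight_le_mul_of_le_norm_sub (p : F) {t : ℝ} (ht : 0 < t) {δ : ℝ} {x : F}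
    (hx : δ ≤ ‖x - p‖) (hδ : 0 ≤ δ) :
    gaussianWeight p t x ≤ ENNReal.ofReal (Real.exp (-δ ^ 2 / (8 * t))) *
      gaussianWeight p (2 * t) x := by
  rw [gaussianWeight, gaussianWeight, ← ENNReal.ofReal_mul (Real.exp_pos _).le, ← Real.exp_add]
  refine ENNReal.ofReal_le_ofReal (Real.exp_le_exp.2 ?_)
  have hsq : δ ^ 2 ≤ ‖x - p‖ ^ 2 := pow_le_pow_left₀ hδ hx 2
  have h8 : (4 : ℝ) * (2 * t) = 8 * t := by ring
  have h1 : -(‖x - p‖ ^ 2) / (4 * t) = -(‖x - p‖ ^ 2) / (8 * t) + -(‖x - p‖ ^ 2) / (8 * t) := by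
    field_simp
    ring
  rw [h8, h1]
  have hnum : -(‖x - p‖ ^ 2) ≤ -(δ ^ 2) := by linarith
  have h8t : (0 : ℝ) ≤ 8 * t := by positivity
  have hdiv := div_le_div_of_nonneg_right hnum h8t
  linarith

/-- The normalizing factors at scales `t` and `2t`: `(4πt)^{-n/2} = 2^{n/2} (4π·2t)^{-n/2}`.
[folklore] -/
theorem gaussianNormalization_eq_mul_two_mul (n : ℕ) {t : ℝ} (ht : 0 < t) :
    gaussianNormalization n t =
      ENNReal.ofReal ((2 : ℝ) ^ ((n : ℝ) / 2)) * gaussianNormalization n (2 * t) := by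
  rw [gaussianNormalization, gaussianNormalization,
    ← ENNReal.ofReal_mul (Real.rpow_nonneg (by norm_num) _)]
  congr 1
  rw [show 4 * Real.pi * (2 * t) = 2 * (4 * Real.pi * t) by ring,
    Real.mul_rpow (x := 2) (y := 4 * Real.pi * t) (by norm_num) (by positivity), ← mul_assoc,
    ← Real.rpow_add (by norm_num : (0 : ℝ) < 2), show (n : ℝ) / 2 + -(n : ℝ) / 2 = 0 by ring,
    Real.rpow_zero, one_mul]

/-- **The far part of a Gaussian area under a Gaussian bound**: for a measurable `S` and
`δ ≥ 0`, `F_{p,t}(S ∖ B(p, δ)) ≤ 2^{n/2} e^{-δ²/8t} · F_{p,2t}(S)`. [folklore] -/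
theorem gaussianArea_diff_ball_le (n : ℕ) (p : F) {t : ℝ} (ht : 0 < t) {S : Set F}
    (hS : MeasurableSet S) {δ : ℝ} (hδ : 0 ≤ δ) :
    gaussianArea n p t (S \ ball p δ) ≤
      ENNReal.ofReal ((2 : ℝ) ^ ((n : ℝ) / 2) * Real.exp (-δ ^ 2 / (8 * t))) *
        gaussianArea n p (2 * t) S := by
  rw [gaussianArea_eq, gaussianArea_eq, gaussianNormalization_eq_mul_two_mul n ht,
    ENNReal.ofReal_mul (Real.rpow_nonneg (by norm_num) _)]
  have hint : ∫⁻ x in S \ ball p δ, gaussianWeight p t x ∂(μHE[n] : Measure F) ≤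
      ENNReal.ofReal (Real.exp (-δ ^ 2 / (8 * t))) *
        ∫⁻ x in S, gaussianWeight p (2 * t) x ∂(μHE[n] : Measure F) := by
    calc ∫⁻ x in S \ ball p δ, gaussianWeight p t x ∂(μHE[n] : Measure F)
        ≤ ∫⁻ x in S \ ball p δ, ENNReal.ofReal (Real.exp (-δ ^ 2 / (8 * t))) *
            gaussianWeight p (2 * t) x ∂(μHE[n] : Measure F) := by
          refine setLIntegral_mono' (hS.diff measurableSet_ball) fun x hx => ?_
          refine gaussianWeight_le_mul_of_le_norm_sub p ht ?_ hδ
          have h := hx.2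
          rw [mem_ball_iff_norm, not_lt] at h
          exact h
      _ = ENNReal.ofReal (Real.exp (-δ ^ 2 / (8 * t))) *
            ∫⁻ x in S \ ball p δ, gaussianWeight p (2 * t) x ∂(μHE[n] : Measure F) :=
          lintegral_const_mul' _ _ ENNReal.ofReal_ne_top
      _ ≤ ENNReal.ofReal (Real.exp (-δ ^ 2 / (8 * t))) *
            ∫⁻ x in S, gaussianWeight p (2 * t) x ∂(μHE[n] : Measure F) :=
          mul_le_mul' le_rfl (lintegral_mono_set fun y hy => hy.1)
  calc ENNReal.ofReal ((2 : ℝ) ^ ((n : ℝ) / 2)) * gaussianNormalization n (2 * t) *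
        ∫⁻ x in S \ ball p δ, gaussianWeight p t x ∂(μHE[n] : Measure F)
      ≤ ENNReal.ofReal ((2 : ℝ) ^ ((n : ℝ) / 2)) * gaussianNormalization n (2 * t) *
          (ENNReal.ofReal (Real.exp (-δ ^ 2 / (8 * t))) *
            ∫⁻ x in S, gaussianWeight p (2 * t) x ∂(μHE[n] : Measure F)) :=
        mul_le_mul' le_rfl hint
    _ = ENNReal.ofReal ((2 : ℝ) ^ ((n : ℝ) / 2)) * ENNReal.ofReal (Real.exp (-δ ^ 2 / (8 * t))) *
          (gaussianNormalization n (2 * t) *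
            ∫⁻ x in S, gaussianWeight p (2 * t) x ∂(μHE[n] : Measure F)) := by ring

/-- The far-part factor tends to `0`: `2^{n/2} e^{-δ²/8t} → 0` as `t → 0⁺` (`δ > 0`). [folklore] -/
theorem tendsto_errFactor (n : ℕ) {δ : ℝ} (hδ : 0 < δ) :
    Tendsto (fun t : ℝ => (2 : ℝ) ^ ((n : ℝ) / 2) * Real.exp (-δ ^ 2 / (8 * t))) (𝓝[>] 0)
      (𝓝 0) := by
  have h1 : Tendsto (fun t : ℝ => δ ^ 2 / 8 * t⁻¹) (𝓝[>] 0) atTop :=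
    tendsto_inv_nhdsGT_zero.const_mul_atTop (by positivity)
  have h2 : Tendsto (fun t : ℝ => Real.exp (-(δ ^ 2 / 8 * t⁻¹))) (𝓝[>] 0) (𝓝 0) :=
    Real.tendsto_exp_neg_atTop_nhds_zero.comp h1
  have h3 : (fun t : ℝ => (2 : ℝ) ^ ((n : ℝ) / 2) * Real.exp (-δ ^ 2 / (8 * t))) =
      fun t => (2 : ℝ) ^ ((n : ℝ) / 2) * Real.exp (-(δ ^ 2 / 8 * t⁻¹)) := by
    funext t
    congr 2
    rw [neg_div, div_mul_eq_div_div, div_eq_mul_inv (δ ^ 2 / 8)]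
  rw [h3]
  simpa using h2.const_mul ((2 : ℝ) ^ ((n : ℝ) / 2))

end Far

/-! ### The local density theorem -/

section Local

variable {EM : Type*} [NormedAddCommGroup EM] [NormedSpace ℝ EM] [FiniteDimensional ℝ EM]
  {F : Type*} [NormedAddCommGroup F] [InnerProductSpace ℝ F] [MeasurableSpace F] [BorelSpace F]

/-- **The Gaussian density of a set at a point near which it is a `C¹` graph is `1`**
(local form of Colding–Minicozzi 2012, Lemma 7.2 (3); White 2005, p. 1497 "by direct
calculation").  Hypotheses: `g` strictly differentiable at `u₀` with injective differential
(`dim E_M = n`); `S` measurable, containing `g(N)` for a neighbourhood `N` of `u₀`, and covered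
near `g u₀` by the image of every neighbourhood of `u₀`; bounded Gaussian areas
`F_{g u₀, t}(S) ≤ Λ < ∞`.  Conclusion: `F_{g u₀, t}(S) → 1` as `t → 0⁺`.
[cite: ColdingMinicozzi2012, Lemma 7.2] [cite: White2005, §2.10 p. 1497] -/
theorem tendsto_gaussianArea_nhdsGT_zero_of_localGraph {n : ℕ} (hn : finrank ℝ EM = n)
    {g : EM → F} {A : EM →L[ℝ] F} {u₀ : EM} (hg : HasStrictFDerivAt g A u₀) (hA : Injective A)
    {S : Set F} (hSm : MeasurableSet S) (hgS : ∃ N ∈ 𝓝 u₀, g '' N ⊆ S)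
    (hloc : ∀ N ∈ 𝓝 u₀, ∃ δ > (0 : ℝ), S ∩ ball (g u₀) δ ⊆ g '' N)
    {Λ : ℝ≥0∞} (hΛ : Λ ≠ ∞) (hbd : ∀ t : ℝ, 0 < t → gaussianArea n (g u₀) t S ≤ Λ) :
    Tendsto (fun t : ℝ => gaussianArea n (g u₀) t S) (𝓝[>] 0) (𝓝 1) := by
  obtain ⟨N₀, hN₀, hgN₀⟩ := hgS
  rw [tendsto_order]
  constructor
  · -- lower bound
    intro a ha
    obtain ⟨q, hq0, haq, hq1⟩ := ENNReal.lt_iff_exists_real_btwn.1 ha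
    rw [ENNReal.ofReal_lt_one] at hq1
    obtain ⟨ε, hε, hε1, hqε⟩ := exists_eps_ratio_pow_gt n hq1
    have ha' : 0 < 1 + ε := by linarith
    have hc' : 0 < 1 - ε := by linarith
    set k : ℝ := ((1 + ε) / (1 - ε)) ^ n with hk
    have hkpos : 0 < k := by positivity
    have hkinv : k⁻¹ = ((1 - ε) / (1 + ε)) ^ n := by
      rw [hk, ← inv_pow, inv_div]
    obtain ⟨r, hr, hpt⟩ := one_le_mul_gaussianArea_image_add hn hg hA hN₀ hε hε1
    -- choose `η > 0` with `(1 - η) / k > q`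
    set η : ℝ := (1 - q * k) / 2 with hη
    have hqk : q * k < 1 := by
      rw [← lt_div_iff₀ hkpos, one_div, hkinv]
      exact hqε
    have hηpos : 0 < η := by rw [hη]; linarith
    have hηq : q < (1 - η) / k := by
      rw [lt_div_iff₀ hkpos, hη]
      linarith
    -- the error term is eventually `≤ η` at the rescaled time `s / (1+ε)²`
    have herr : ∀ᶠ s : ℝ in 𝓝[>] 0,
        (2 : ℝ) ^ ((n : ℝ) / 2) * Real.exp (-r ^ 2 / (8 * (s / (1 + ε) ^ 2))) < η := by
      have h1 : Tendsto (fun s : ℝ => s / (1 + ε) ^ 2) (𝓝[>] 0) (𝓝[>] 0) := by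
        refine tendsto_nhdsWithin_of_tendsto_nhds_of_eventually_within _ ?_ ?_
        · have : Tendsto (fun s : ℝ => s / (1 + ε) ^ 2) (𝓝 0) (𝓝 (0 / (1 + ε) ^ 2)) :=
            tendsto_id.div_const _
          rw [zero_div] at this
          exact this.mono_left nhdsWithin_le_nhds
        · filter_upwards [self_mem_nhdsWithin] with s hs
          exact div_pos (mem_Ioi.1 hs) (by positivity)
      exact h1.eventually ((tendsto_order.1 (tendsto_errFactor n hr)).2 _ hηpos)
    filter_upwards [herr, self_mem_nhdsWithin] with s hs hs0
    rw [mem_Ioi] at hs0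
    have hsε : 0 < s / (1 + ε) ^ 2 := by positivity
    have h1 := hpt (s / (1 + ε) ^ 2) hsε
    rw [div_mul_cancel₀ s (by positivity : (1 + ε) ^ 2 ≠ 0)] at h1
    -- `1 ≤ k * F(g N₀) + E` with `E < η`; and `F(g N₀) ≤ F(S)`
    have h2 : (1 : ℝ≥0∞) ≤ ENNReal.ofReal k * gaussianArea n (g u₀) s S + ENNReal.ofReal η := by
      refine h1.trans (add_le_add (mul_le_mul' le_rfl (gaussianArea_mono _ _ _ hgN₀)) ?_)
      exact ENNReal.ofReal_le_ofReal hs.le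
    by_cases htop : gaussianArea n (g u₀) s S = ∞
    · rw [htop]
      exact haq.trans_le le_top
    · set G := (gaussianArea n (g u₀) s S).toReal with hG
      have hGeq : gaussianArea n (g u₀) s S = ENNReal.ofReal G :=
        (ENNReal.ofReal_toReal htop).symm
      rw [hGeq] at h2 ⊢
      have hG0 : 0 ≤ G := ENNReal.toReal_nonneg
      rw [← ENNReal.ofReal_mul hkpos.le, ← ENNReal.ofReal_add (by positivity) hηpos.le,
        ENNReal.one_le_ofReal] at h2
      refine haq.trans ((ENNReal.ofReal_lt_ofReal_iff (by nlinarith)).2 ?_)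
      rw [lt_div_iff₀ hkpos] at hηq
      nlinarith
  · -- upper bound
    intro b hb
    obtain ⟨b', hb1, hb'⟩ : ∃ b' : ℝ, 1 < b' ∧ ENNReal.ofReal b' ≤ b := by
      by_cases hbt : b = ∞
      · exact ⟨2, one_lt_two, hbt ▸ le_top⟩
      · refine ⟨b.toReal, ?_, (ENNReal.ofReal_toReal hbt).le⟩
        have := ENNReal.toReal_strict_mono hbt hb
        rwa [ENNReal.toReal_one] at this
    set b₁ : ℝ := (1 + b') / 2 with hb₁
    have hb₁1 : 1 < b₁ := by rw [hb₁]; linarith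
    have hb₁b : b₁ < b' := by rw [hb₁]; linarith
    obtain ⟨ε, hε, hε1, hKε⟩ := exists_eps_ratio_pow_lt n hb₁1
    have ha' : 0 < 1 + ε := by linarith
    have hc' : 0 < 1 - ε := by linarith
    obtain ⟨T, hTfd, h, r, hTn, hr, h0, hlip, hco, -, N, hN, hgN⟩ :=
      exists_biLipschitz_tangent_reparam hn hg hA univ_mem hε
    haveI := hTfd
    obtain ⟨δ, hδ, hlocδ⟩ := hloc N hN
    have hlocal : S ∩ ball (g u₀) δ ⊆ h '' ball (0 : T) r := hlocδ.trans hgN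
    -- the far part tends to zero
    have hfarlim : Tendsto (fun s : ℝ => ENNReal.ofReal ((2 : ℝ) ^ ((n : ℝ) / 2) *
        Real.exp (-δ ^ 2 / (8 * s))) * Λ) (𝓝[>] 0) (𝓝 0) := by
      have h1 := ENNReal.tendsto_ofReal (tendsto_errFactor n hδ)
      rw [ENNReal.ofReal_zero] at h1
      have h2 := ENNReal.Tendsto.mul_const h1 (Or.inr hΛ)
      rwa [zero_mul] at h2
    have hgap : (0 : ℝ≥0∞) < ENNReal.ofReal (b' - b₁) := ENNReal.ofReal_pos.2 (by linarith)
    have hfar_ev : ∀ᶠ s : ℝ in 𝓝[>] 0, ENNReal.ofReal ((2 : ℝ) ^ ((n : ℝ) / 2) *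
        Real.exp (-δ ^ 2 / (8 * s))) * Λ < ENNReal.ofReal (b' - b₁) :=
      (tendsto_order.1 hfarlim).2 _ hgap
    filter_upwards [hfar_ev, self_mem_nhdsWithin] with s hsfar hs0
    rw [mem_Ioi] at hs0
    have hsplit : S = (S ∩ ball (g u₀) δ) ∪ (S \ ball (g u₀) δ) := by
      ext y
      constructor
      · intro hy
        by_cases hyb : y ∈ ball (g u₀) δ
        exacts [Or.inl ⟨hy, hyb⟩, Or.inr ⟨hy, hyb⟩]
      · rintro (⟨hy, -⟩ | ⟨hy, -⟩) <;> exact hy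
    have hnear : gaussianArea n (g u₀) s (S ∩ ball (g u₀) δ) ≤
        ENNReal.ofReal (((1 + ε) / (1 - ε)) ^ n) := by
      calc gaussianArea n (g u₀) s (S ∩ ball (g u₀) δ)
          ≤ gaussianArea n (g u₀) s (h '' ball (0 : T) r) := gaussianArea_mono _ _ _ hlocal
        _ ≤ ENNReal.ofReal (((1 + ε) / (1 - ε)) ^ n) *
              gaussianArea n (0 : T) (s / (1 - ε) ^ 2) (ball 0 r) := by
            rw [← h0]
            exact gaussianArea_image_le (n := n) hε hε1 hr hlip hco hs0
        _ ≤ ENNReal.ofReal (((1 + ε) / (1 - ε)) ^ n) * 1 := by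
            refine mul_le_mul' le_rfl ?_
            rw [← gaussianArea_zero_univ hTn (by positivity : (0 : ℝ) < s / (1 - ε) ^ 2)]
            exact gaussianArea_mono _ _ _ (subset_univ _)
        _ = ENNReal.ofReal (((1 + ε) / (1 - ε)) ^ n) := mul_one _
    have hfar : gaussianArea n (g u₀) s (S \ ball (g u₀) δ) ≤
        ENNReal.ofReal ((2 : ℝ) ^ ((n : ℝ) / 2) * Real.exp (-δ ^ 2 / (8 * s))) * Λ :=
      (gaussianArea_diff_ball_le n (g u₀) hs0 hSm hδ.le).trans
        (mul_le_mul' le_rfl (hbd _ (by positivity)))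
    calc gaussianArea n (g u₀) s S
        = gaussianArea n (g u₀) s ((S ∩ ball (g u₀) δ) ∪ (S \ ball (g u₀) δ)) := by
          rw [← hsplit]
      _ ≤ gaussianArea n (g u₀) s (S ∩ ball (g u₀) δ) +
          gaussianArea n (g u₀) s (S \ ball (g u₀) δ) := gaussianArea_union_le _ _ _ _ _
      _ ≤ ENNReal.ofReal (((1 + ε) / (1 - ε)) ^ n) +
          ENNReal.ofReal ((2 : ℝ) ^ ((n : ℝ) / 2) * Real.exp (-δ ^ 2 / (8 * s))) * Λ :=
          add_le_add hnear hfar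
      _ < ENNReal.ofReal b₁ + ENNReal.ofReal (b' - b₁) :=
          ENNReal.add_lt_add_of_le_of_lt ENNReal.ofReal_ne_top (ENNReal.ofReal_le_ofReal hKε.le)
            hsfar
      _ = ENNReal.ofReal b' := by
          rw [← ENNReal.ofReal_add (by linarith) (by linarith)]
          congr 1
          ring
      _ ≤ b := hb'

end Local

end Literature.Geometry.Riemannian
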